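import Summits.AtomisticToContinuum.HydrodynamicLimit.Theorems.LambertianContactSwapLambertianEulerJointMeasurable
import Summits.AtomisticToContinuum.HydrodynamicLimit.Theorems.OneFlightGossipEngineClampedCurrentsDockWindowBalance
import Summits.AtomisticToContinuum.HydrodynamicLimit.Theorems.TwoClocksClampedEntropyClockKlDivLawAtLocalGibbsNeTop
import Mathlib.Analysis.Calculus.FDeriv.Measurable
import Literature.MathematicalPhysics.KineticTheory.LambertianRedrawNondegenerate
import HarnessLib

/-!
# Fubini for the windowed streaming term of the Lambertian gas
# (crux `LambertianEuler`, stmt-AtomisticToContinuum-11854, line `Sketch`; tool E2 of the kernel's ESTIMATE)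

Helper file (`--supports`) of the crux
`Summit.AtomisticToContinuum.HydrodynamicLimit.Theses.LindebergRandomFuture.LambertianEuler`, line `Sketch`.
The FORMULA of the line (`…ExpectedWindowProduction.stub_expectedWindowProductionLambda`) expresses the expected
one-window entropy production of the Lambertian gas `Λ` through `E_λ[∫_s^{s+h} Σ_i Dg_r((Λ_r)_i) dr]`, the
expectation of the windowed streaming integral of the one-body exponent's streaming rate
`Dg = ∂_t g + v·∇g` (`ClampedCurrentsDockPathwise.DgExp` / `DgSum`).  Every estimate of it (Yau's method) is
made at FIXED times under the one-time laws `μ_r = λ ∘ Λ_r⁻¹`; this file supplies the exchange of the two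
integrals:

* `exists_measurable_eq_DgExp` — a jointly measurable representative of the streaming rate on the open time
  interval: for profiles jointly smooth on `[0, T)`, `a, θ > 0`, there is a measurable `Φ : ℝ × (𝕋³ × ℝ³) → ℝ` with
  `Φ(t, y) = Dg_t(y)` for `t ∈ (0, T)` (at interior times the one-sided space–time derivative is the Fréchet
  derivative of the lift, which is a measurable function of the base point — `measurable_fderiv` — evaluated,
  jointly continuously, at the measurable direction `(1, v)`; the `v`-dependence of the exponent is the explicit
  polynomial `g = g(·,0) + ⟪v, u/θ⟫ − |v|²/(2θ)`).
* `integral_window_streaming_swap` — under `λ = λ_N ⊗ γ^ℕ` (local Gibbs data, `0 < σ < 1/2`), for a window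
  `0 ≤ s ≤ s + h < T`: `(p, r) ↦ Σ_i Dg_r((Λ_r p)_i)` is integrable on `λ ⊗ dr|_{(s, s+h]}` and
  `E_λ[∫_s^{s+h} Σ_i Dg_r(Λ_r) dr] = ∫_s^{s+h} E_λ[Σ_i Dg_r(Λ_r)] dr` (joint measurability of `Λ` —
  `…JointMeasurable.measurable_lambertFlow_uncurry_torus` —, cubic growth of `Dg`, energy monotonicity of `Λ`,
  Gaussian moments, `integral_integral_swap`).
* `integral_DgSum_lambertFlow_eq_integral_map` — and each one-time expectation is an expectation under the
  one-time law: `E_λ[Σ_i Dg_r(Λ_r)] = ∫ Σ_i Dg_r dμ_r`, `r ∈ (0, T)`.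

References: H.-T. Yau, Lett. Math. Phys. 22 (1991) §2 (the production is estimated at fixed times);
measure theory otherwise. All `[folklore]`.
-/

noncomputable section

namespace Summit.AtomisticToContinuum.HydrodynamicLimit.Theorems.LambertianContactSwapLambertianEulerStreamingFubini

open scoped BigOperators Topology ENNReal InnerProductSpace
open MeasureTheory ProbabilityTheory Filter Set InformationTheory
open Literature.MathematicalPhysics.KineticTheory
open Literature.Analysis.FluidPDE Literature.Analysis.FluidPDE.Alexander
open Literature.Analysis.FunctionSpaces
open Summit.AtomisticToContinuum.HydrodynamicLimit.Theorems.ClampedCurrentsDockPathwise (gExp gSum DgExp DgSum isSmoothSpaceTimeOn_gExp)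

/-! ## §1 A measurable representative of the streaming rate on `(0, T)` -/

section Rate

variable {T : ℝ} {a θ : ℝ → T3 → ℝ} {u : ℝ → T3 → V3}

/-- **The streaming rate is jointly measurable in `(t, x, v)` on the open time interval.** There is a
measurable `Φ : ℝ × (𝕋³ × ℝ³) → ℝ` with `Φ (t, (x, v)) = Dg_t(x, v)` for all `t ∈ (0, T)`, `x`, `v`: at interior
times `Dg_t(x, v) = D(stLift g_v)(t, repr x)(1, v)` and
`D(stLift g_v) = D(stLift g₀) + ⟪v, D(stLift (u/θ))·⟫ + |v|² D(stLift (−1/2θ))`, each Fréchet derivative being a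
measurable function of the base point (`measurable_fderiv`) and `(L, w) ↦ L w` jointly continuous. [folklore] -/
theorem exists_measurable_eq_DgExp (ha : Torus.IsSmoothSpaceTimeOn (Ico 0 T) a)
    (hθ : Torus.IsSmoothSpaceTimeOn (Ico 0 T) θ) (hu : Torus.IsSmoothSpaceTimeOn (Ico 0 T) u)
    (ha0 : ∀ t ∈ Ico 0 T, ∀ x, 0 < a t x) (hθ0 : ∀ t ∈ Ico 0 T, ∀ x, 0 < θ t x) :
    ∃ Φ : ℝ × (T3 × V3) → ℝ, Measurable Φ ∧ ∀ t ∈ Ioo 0 T, ∀ y : T3 × V3, Φ (t, y) = DgExp T a θ u t y := by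
  have hU : UniqueDiffOn ℝ (Ico (0 : ℝ) T) := uniqueDiffOn_Ico 0 T
  have hU' : UniqueDiffOn ℝ (Ico (0 : ℝ) T ×ˢ (univ : Set V3)) := hU.prod uniqueDiffOn_univ
  -- the coefficient fields and the decomposition of the exponent (as in `exists_abs_DgExp_le`)
  set J : ℝ → T3 → V3 := fun t x => (θ t x)⁻¹ • u t x with hJ_def
  set μ : ℝ → T3 → ℝ := fun t x => -(2 * θ t x)⁻¹ with hμ_def
  have hpoly : ∀ (t : ℝ) (x : T3) (v : V3),
      gExp a θ u t (x, v) = gExp a θ u t (x, 0) + ⟪v, J t x⟫_ℝ + ‖v‖ ^ 2 • μ t x := fun t x v => by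
    simp only [gExp, hJ_def, hμ_def, zero_sub, norm_neg, real_inner_smul_right, smul_eq_mul]
    rw [norm_sub_sq_real]
    ring
  have hθ' : ∀ p ∈ Ico 0 T ×ˢ (univ : Set V3), Torus.stLift θ p ≠ 0 := fun p hp =>
    (hθ0 p.1 (mem_prod.1 hp).1 (Torus.proj p.2)).ne'
  have hJ : Torus.IsSmoothSpaceTimeOn (Ico 0 T) J := by
    show ContDiffOn ℝ _ (fun p : ℝ × V3 => (Torus.stLift θ p)⁻¹ • Torus.stLift u p) (Ico 0 T ×ˢ univ)
    exact (ContDiffOn.inv hθ hθ').smul hu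
  have hμ : Torus.IsSmoothSpaceTimeOn (Ico 0 T) μ := by
    show ContDiffOn ℝ _ (fun p : ℝ × V3 => -(2 * Torus.stLift θ p)⁻¹) (Ico 0 T ×ˢ univ)
    exact (ContDiffOn.inv (contDiffOn_const.mul hθ) fun p hp => mul_ne_zero two_ne_zero (hθ' p hp)).neg
  have hg := fun v : V3 => isSmoothSpaceTimeOn_gExp ha hθ hu ha0 hθ0 v
  -- the three Fréchet derivatives of the lifts, measurable functions of the base point
  set L₀ : ℝ × V3 → (ℝ × V3 →L[ℝ] ℝ) := fderiv ℝ (Torus.stLift fun t' x' => gExp a θ u t' (x', 0)) with hL₀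
  set L₁ : ℝ × V3 → (ℝ × V3 →L[ℝ] V3) := fderiv ℝ (Torus.stLift J) with hL₁
  set L₂ : ℝ × V3 → (ℝ × V3 →L[ℝ] ℝ) := fderiv ℝ (Torus.stLift μ) with hL₂
  have hL₀m : Measurable L₀ := measurable_fderiv ℝ _
  have hL₁m : Measurable L₁ := measurable_fderiv ℝ _
  have hL₂m : Measurable L₂ := measurable_fderiv ℝ _
  -- the representative
  set base : ℝ × (T3 × V3) → ℝ × V3 := fun q => (q.1, Torus.repr q.2.1) with hbase
  set dir : ℝ × (T3 × V3) → ℝ × V3 := fun q => ((1 : ℝ), q.2.2) with hdir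
  have hbm : Measurable base := measurable_fst.prodMk (Torus.measurable_repr.comp (measurable_fst.comp measurable_snd))
  have hdm : Measurable dir := measurable_const.prodMk (measurable_snd.comp measurable_snd)
  have hvm : Measurable fun q : ℝ × (T3 × V3) => q.2.2 := measurable_snd.comp measurable_snd
  have hevR : Measurable fun p : (ℝ × V3 →L[ℝ] ℝ) × (ℝ × V3) => p.1 p.2 :=
    (isBoundedBilinearMap_apply (𝕜 := ℝ) (E := ℝ × V3) (F := ℝ)).continuous.measurable
  have hevV : Measurable fun p : (ℝ × V3 →L[ℝ] V3) × (ℝ × V3) => p.1 p.2 :=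
    (isBoundedBilinearMap_apply (𝕜 := ℝ) (E := ℝ × V3) (F := V3)).continuous.measurable
  refine ⟨fun q => L₀ (base q) (dir q) + ⟪q.2.2, L₁ (base q) (dir q)⟫_ℝ + ‖q.2.2‖ ^ 2 * L₂ (base q) (dir q), ?_, ?_⟩
  · refine ((hevR.comp ((hL₀m.comp hbm).prodMk hdm)).add (hvm.inner (hevV.comp ((hL₁m.comp hbm).prodMk hdm)))).add
      ((hvm.norm.pow_const 2).mul (hevR.comp ((hL₂m.comp hbm).prodMk hdm)))
  · intro t ht y
    obtain ⟨x, v⟩ := y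
    have htS : t ∈ Ico 0 T := Ioo_subset_Ico_self ht
    have hmem : (t, Torus.repr x) ∈ Ico 0 T ×ˢ (univ : Set V3) := mk_mem_prod htS (mem_univ _)
    have hnhds : Ico 0 T ×ˢ (univ : Set V3) ∈ 𝓝 (t, Torus.repr x) :=
      prod_mem_nhds (mem_of_superset (Ioo_mem_nhds ht.1 ht.2) Ioo_subset_Ico_self) univ_mem
    -- (a) the streaming rate is the space–time derivative of the lifted exponent in the direction `(1, v)`
    have hDg : DgExp T a θ u t (x, v) = fderivWithin ℝ (Torus.stLift fun t' x' => gExp a θ u t' (x', v))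
        (Ico 0 T ×ˢ univ) (t, Torus.repr x) (1, v) := by
      conv_lhs => rw [← Torus.proj_repr x]
      dsimp only [DgExp]
      rw [show ((1 : ℝ), v) = ((1 : ℝ), (0 : V3)) + ((0 : ℝ), v) by simp, map_add,
        (hg v).timeDerivWithin_apply_proj hU htS, ← (hg v).fderiv_slice_apply htS,
        Torus.fderiv_apply_eq_sum_partialDeriv (((hg v).isSmooth_slice htS).isContDiff (by simp))]
      simp only [smul_eq_mul]
    -- (b) the derivative splits along the decomposition of the exponent
    have hsplitD : fderivWithin ℝ (Torus.stLift fun t' x' => gExp a θ u t' (x', v)) (Ico 0 T ×ˢ univ)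
        (t, Torus.repr x) =
          fderivWithin ℝ (Torus.stLift fun t' x' => gExp a θ u t' (x', 0)) (Ico 0 T ×ˢ univ) (t, Torus.repr x) +
          (innerSL ℝ v).comp (fderivWithin ℝ (Torus.stLift J) (Ico 0 T ×ˢ univ) (t, Torus.repr x)) +
          ‖v‖ ^ 2 • fderivWithin ℝ (Torus.stLift μ) (Ico 0 T ×ˢ univ) (t, Torus.repr x) := by
      have d0 := ((hg 0).differentiableOn (by simp) _ hmem).hasFDerivWithinAt
      have dJ := (hJ.differentiableOn (by simp) _ hmem).hasFDerivWithinAt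
      have dμ := (hμ.differentiableOn (by simp) _ hmem).hasFDerivWithinAt
      refine (((d0.add ((innerSL ℝ v).hasFDerivAt.comp_hasFDerivWithinAt _ dJ)).add
        (dμ.const_smul (‖v‖ ^ 2))).congr' (fun p _ => ?_) hmem).fderivWithin (hU' _ hmem)
      simp only [Pi.add_apply, Pi.smul_apply, Function.comp_apply, Torus.stLift, innerSL_apply_apply]
      exact hpoly p.1 (Torus.proj p.2) v
    -- (c) at interior times the one-sided derivatives are Fréchet derivatives
    rw [hDg, hsplitD, fderivWithin_of_mem_nhds hnhds, fderivWithin_of_mem_nhds hnhds, fderivWithin_of_mem_nhds hnhds]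
    simp only [hL₀, hL₁, hL₂, hbase, hdir, add_apply, smul_apply,
      ContinuousLinearMap.comp_apply, innerSL_apply_apply, smul_eq_mul]

end Rate

/-! ## §2 The exchange of the window and the expectation -/

section Swap

variable {σ T : ℝ} {a₀ θ₀ : T3 → ℝ} {u₀ : T3 → V3} {a θ : ℝ → T3 → ℝ} {u : ℝ → T3 → V3} {N : ℕ}

/-- **Fubini for the windowed streaming term.** Under local Gibbs data ⊗ noise (`0 < σ < 1/2`, continuous
positive data profiles), for profiles `a, θ > 0`, `u` jointly smooth on `[0, T)` and a window `0 ≤ s ≤ s + h < T`: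
`((z, ξs), r) ↦ Σ_i Dg_r((Λ_r)_i)` is integrable on `(λ_N ⊗ γ^ℕ) ⊗ dr|_{(s, s+h]}` and
`E[∫_s^{s+h} Σ_i Dg_r(Λ_r) dr] = ∫_s^{s+h} E[Σ_i Dg_r(Λ_r)] dr` (measurable representative of `Dg` on `(0, T) ∋ r`,
joint measurability of `Λ`, domination by `(N+1) C (3 + 5E₀ + (N+1) Σ_i |v_i|⁴)` via the cubic growth of `Dg`
and `E(Λ_r) ≤ E(z)`, Gaussian moments; `integral_integral_swap`). [folklore] -/
theorem integral_window_streaming_swap : ∀ {σ T : ℝ} {a₀ θ₀ : T3 → ℝ} {u₀ : T3 → V3} {a θ : ℝ → T3 → ℝ} {u : ℝ → T3 → V3} {N : ℕ}, 0 < σ → σ < 2⁻¹ → Continuous a₀ → Continuous θ₀ → Continuous u₀ → (∀ x, 0 < a₀ x) → (∀ x, 0 < θ₀ x) → ∀ (Φ : HardSphereFlow (Torus.geometry (Fin 3)) (hsDiameter σ N) (N + 1)), Torus.IsSmoothSpaceTimeOn (Set.Ico 0 T) a → Torus.IsSmoothSpaceTimeOn (Set.Ico 0 T) θ → Torus.IsSmoothSpaceTimeOn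 (Set.Ico 0 T) u → (∀ t ∈ Set.Ico 0 T, ∀ x, 0 < a t x) → (∀ t ∈ Set.Ico 0 T, ∀ x, 0 < θ t x) → ∀ {s h : ℝ}, 0 ≤ s → 0 ≤ h → s + h < T → Integrable (fun q : (Config (N + 1) (Fin 3) T3 × (ℕ → V3)) × ℝ => DgSum T a θ u q.2 (lambertFlow (Torus.geometry (Fin 3)) (hsDiameter σ N) q.1.2 q.1.1 q.2)) (((localGibbsLaw σ a₀ u₀ θ₀ N Φ).prod (lambertNoise (Fin 3))).prod (volume.restrict (Set.Ioc s (s + h)))) ∧ ∫ p, (∫ r in s..(s + h), DgSum T a θ u r (lambertFlow (Torus.geometry (Fin 3)) (hsDiameter σ N) p.2 p.1 r)) ∂((localGibbsLaw σ a₀ u₀ θ₀ N Φ).prod (lambertNoise (Fin 3))) = ∫ r in s..(s + h), (∫ p, DgSum T a θ u r (lambertFlow (Torus.geometry (Fin 3)) (hsDiameter σ N) p.2 p.1 r) ∂((localGibbsLaw σ a₀ u₀ θ₀ N Φ).prod (lambertNoise (Fin 3)))) := by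
  intro σ T a₀ θ₀ u₀ a θ u N hσ hσ' ha₀ hθ₀ hu₀ ha₀0 hθ₀0 Φ ha hθ hu ha0 hθ0 s h hs hh hshT
  have hσ2 : σ ≤ 1 / 2 := by rw [one_div]; exact hσ'.le
  have hsb : s ≤ s + h := le_add_of_nonneg_right hh
  haveI : IsProbabilityMeasure (localGibbsLaw σ a₀ u₀ θ₀ N Φ) :=
    isProbabilityMeasure_localGibbsLaw ha₀ hθ₀ hu₀ ha₀0 hθ₀0 hσ2 N Φ
  set P := (localGibbsLaw σ a₀ u₀ θ₀ N Φ).prod (lambertNoise (Fin 3)) with hP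
  set ν : Measure ℝ := volume.restrict (Ioc s (s + h)) with hν
  -- joint measurability: the representative of `Dg` on `(0, T)` composed with the jointly measurable flow
  obtain ⟨Φm, hΦm, hΦeq⟩ := exists_measurable_eq_DgExp ha hθ hu ha0 hθ0
  have hΛ := LambertianContactSwapLambertianEulerJointMeasurable.measurable_lambertFlow_uncurry_torus hσ.le hσ' N
  have hGm : Measurable fun q : (Config (N + 1) (Fin 3) T3 × (ℕ → V3)) × ℝ =>
      ∑ i, Φm (q.2, lambertFlow (Torus.geometry (Fin 3)) (hsDiameter σ N) q.1.2 q.1.1 q.2 i) :=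
    Finset.measurable_sum _ fun i _ => hΦm.comp (measurable_snd.prodMk ((measurable_pi_apply i).comp hΛ))
  have hIoo : ∀ r ∈ Ioc s (s + h), r ∈ Ioo 0 T := fun r hr => ⟨hs.trans_lt hr.1, hr.2.trans_lt hshT⟩
  have hGeq : ∀ r ∈ Ioc s (s + h), ∀ w : Config (N + 1) (Fin 3) T3, DgSum T a θ u r w = ∑ i, Φm (r, w i) :=
    fun r hr w => Finset.sum_congr rfl fun i _ => (hΦeq r (hIoo r hr) (w i)).symm
  have hae : ∀ᵐ q ∂(P.prod ν), q.2 ∈ Ioc s (s + h) :=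
    (Measure.quasiMeasurePreserving_snd (μ := P) (ν := ν)).ae (ae_restrict_mem measurableSet_Ioc)
  have hfm : AEStronglyMeasurable (fun q : (Config (N + 1) (Fin 3) T3 × (ℕ → V3)) × ℝ =>
      DgSum T a θ u q.2 (lambertFlow (Torus.geometry (Fin 3)) (hsDiameter σ N) q.1.2 q.1.1 q.2)) (P.prod ν) := by
    refine hGm.aestronglyMeasurable.congr ?_
    filter_upwards [hae] with q hq using (hGeq q.2 hq _).symm
  -- domination
  obtain ⟨C, hC0, hC⟩ := ClampedCurrentsDockWindowBalance.exists_abs_DgExp_le ha hθ hu ha0 hθ0 hs hshT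
  have hE1 : Integrable (fun p : Config (N + 1) (Fin 3) T3 × (ℕ → V3) => ∑ i, ‖(p.1 i).2‖ ^ 2) P :=
    (QuenchedCellClock.integrable_sum_norm_sq_localGibbsLaw ha₀ hθ₀ hu₀ (fun x => (ha₀0 x).le) hθ₀0 N Φ).comp_fst _
  have hE4 : Integrable (fun p : Config (N + 1) (Fin 3) T3 × (ℕ → V3) => ∑ i, ‖(p.1 i).2‖ ^ 4) P :=
    (ClampedCurrentsDockWindowBalance.integrable_sum_norm_pow_four_localGibbsLaw ha₀ hθ₀ hu₀ (fun x => (ha₀0 x).le)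
      hθ₀0 σ N Φ).comp_fst _
  have hBP : Integrable (fun p : Config (N + 1) (Fin 3) T3 × (ℕ → V3) => ((N : ℝ) + 1) * C *
      (3 + 5 * ∑ i, ‖(p.1 i).2‖ ^ 2 + ((N : ℝ) + 1) * ∑ i, ‖(p.1 i).2‖ ^ 4)) P :=
    Integrable.const_mul (((integrable_const _).add (hE1.const_mul _)).add (hE4.const_mul _)) _
  haveI : IsFiniteMeasure ν := by rw [hν]; infer_instance
  have hB : Integrable (fun q : (Config (N + 1) (Fin 3) T3 × (ℕ → V3)) × ℝ => ((N : ℝ) + 1) * C *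
      (3 + 5 * ∑ i, ‖(q.1.1 i).2‖ ^ 2 + ((N : ℝ) + 1) * ∑ i, ‖(q.1.1 i).2‖ ^ 4)) (P.prod ν) := hBP.comp_fst _
  have hInt : Integrable (fun q : (Config (N + 1) (Fin 3) T3 × (ℕ → V3)) × ℝ =>
      DgSum T a θ u q.2 (lambertFlow (Torus.geometry (Fin 3)) (hsDiameter σ N) q.1.2 q.1.1 q.2)) (P.prod ν) := by
    refine hB.mono' hfm ?_
    filter_upwards [hae] with q hq
    have hS0 : 0 ≤ ∑ i, ‖(q.1.1 i).2‖ ^ 2 := Finset.sum_nonneg fun i _ => by positivity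
    have hm : ∑ i, ‖(lambertFlow (Torus.geometry (Fin 3)) (hsDiameter σ N) q.1.2 q.1.1 q.2 i).2‖ ^ 2 ≤
        ∑ i, ‖(q.1.1 i).2‖ ^ 2 := by
      have h := configEnergy_lambertFlow_le (G := Torus.geometry (Fin 3)) (ε := hsDiameter σ N) q.1.2 q.1.1 q.2
      simp only [configEnergy] at h
      linarith
    have hL0 : 0 ≤ ∑ i, ‖(lambertFlow (Torus.geometry (Fin 3)) (hsDiameter σ N) q.1.2 q.1.1 q.2 i).2‖ ^ 2 :=
      Finset.sum_nonneg fun i _ => by positivity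
    have hCS : (∑ i, ‖(q.1.1 i).2‖ ^ 2) ^ 2 ≤ ((N : ℝ) + 1) * ∑ i, ‖(q.1.1 i).2‖ ^ 4 := by
      have hcs := sq_sum_le_card_mul_sum_sq (s := Finset.univ) (f := fun i : Fin (N + 1) => ‖(q.1.1 i).2‖ ^ 2)
      simpa only [Finset.card_univ, Fintype.card_fin, Nat.cast_add, Nat.cast_one, ← pow_mul] using hcs
    rw [Real.norm_eq_abs]
    refine (ClampedCurrentsDockWindowBalance.abs_DgSum_le hC0 (hC q.2 (Ioc_subset_Icc_self hq)) _).trans ?_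
    have hN0 : (0 : ℝ) ≤ ((N : ℝ) + 1) * C := by positivity
    refine mul_le_mul_of_nonneg_left ?_ hN0
    nlinarith [mul_le_mul hm hm hL0 hS0]
  refine ⟨hInt, ?_⟩
  -- the swap
  have hswap := MeasureTheory.integral_integral_swap (μ := P) (ν := ν)
    (f := fun (p : Config (N + 1) (Fin 3) T3 × (ℕ → V3)) (r : ℝ) =>
      DgSum T a θ u r (lambertFlow (Torus.geometry (Fin 3)) (hsDiameter σ N) p.2 p.1 r)) hInt
  simp only [intervalIntegral.integral_of_le hsb]
  exact hswap

/-- **One-time expectations are expectations under the one-time law**: for `r ∈ (0, T)`,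
`E_λ[Σ_i Dg_r(Λ_r)] = ∫ Σ_i Dg_r dμ_r`, `μ_r = (λ_N ⊗ γ^ℕ) ∘ Λ_r⁻¹` (measurability of `w ↦ Σ_i Dg_r(w_i)` through the
representative; `integral_map`). [folklore] -/
theorem integral_DgSum_lambertFlow_eq_integral_map (hσ : 0 ≤ σ) (hσ' : σ < 2⁻¹)
    (ha : Torus.IsSmoothSpaceTimeOn (Ico 0 T) a) (hθ : Torus.IsSmoothSpaceTimeOn (Ico 0 T) θ)
    (hu : Torus.IsSmoothSpaceTimeOn (Ico 0 T) u) (ha0 : ∀ t ∈ Ico 0 T, ∀ x, 0 < a t x)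
    (hθ0 : ∀ t ∈ Ico 0 T, ∀ x, 0 < θ t x) (P : Measure (Config (N + 1) (Fin 3) T3 × (ℕ → V3))) {r : ℝ}
    (hr : r ∈ Ioo 0 T) :
    ∫ p, DgSum T a θ u r (lambertFlow (Torus.geometry (Fin 3)) (hsDiameter σ N) p.2 p.1 r) ∂P =
      ∫ w, DgSum T a θ u r w ∂(P.map (fun p => lambertFlow (Torus.geometry (Fin 3)) (hsDiameter σ N) p.2 p.1 r)) := by
  obtain ⟨Φm, hΦm, hΦeq⟩ := exists_measurable_eq_DgExp ha hθ hu ha0 hθ0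
  have hmeas : Measurable fun w : Config (N + 1) (Fin 3) T3 => DgSum T a θ u r w := by
    have e : (fun w : Config (N + 1) (Fin 3) T3 => DgSum T a θ u r w) = fun w => ∑ i, Φm (r, w i) :=
      funext fun w => Finset.sum_congr rfl fun i _ => (hΦeq r hr (w i)).symm
    rw [e]
    exact Finset.measurable_sum _ fun i _ => hΦm.comp (measurable_const.prodMk (measurable_pi_apply i))
  exact (integral_map (measurable_lambertFlow_hsDiameter hσ hσ' N r).aemeasurable hmeas.aestronglyMeasurable).symm

end Swap

end Summit.AtomisticToContinuum.HydrodynamicLimit.Theorems.LambertianContactSwapLambertianEulerStreamingFubini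

end
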